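import Literature.Analysis.FluidPDE.LerayGaugeStrainSpectrum
import Literature.Analysis.FluidPDE.WholeSpaceIBP
import Literature.Analysis.FluidPDE.VectorCalculusProofs
import Mathlib.LinearAlgebra.CrossProduct
import HarnessLib

/-!
# The Jacobian determinant is a null Lagrangian: `det ∇V = div (V₀ ∇V₁ × ∇V₂)` tested against a cutoff

Analysis/FluidPDE support file (all results proved; used by the localised similarity-enstrophy
estimate of the crux `MustSqueeze`, route SqueezeCycle, NavierStokesRegularity, where the cubic
term `4 ∫ φ det ∇U` of Betchov's enstrophy-production identity must be shown to be a pure flux).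
For a smooth `V : ℝ³ → ℝ³` with coordinate functions `Vᵢ` and a compactly supported smooth `φ`:

* `det_fderiv_eq_inner_gradient_cross` — `det ∇V(y) = ⟪∇V₀, ∇V₁ × ∇V₂⟫` (the determinant as the
  triple product of the rows of the Jacobian matrix);
* `divergence_cross_gradient_gradient` — `div (∇V₁ × ∇V₂) = 0` (`curl ∇ = 0`);
* `integral_mul_det_fderiv_eq` — **the null-Lagrangian flux identity**
  `∫ φ det ∇V = −∫ V₀ ⟪∇V₁ × ∇V₂, ∇φ⟫` (Ball, Arch. Ration. Mech. Anal. 63 (1977), §3: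
  sub-determinants of the gradient are divergences; Evans, *PDE*, §8.1.4.b, Lemma (divergence
  structure of determinants) and Thm. 2 (`det` is a null Lagrangian));
* `abs_mul_inner_cross_gradient_le` — the pointwise flux bound
  `|V₀ ⟪∇V₁ × ∇V₂, ∇φ⟫| ≤ ½ ‖V‖ ‖∇φ‖ ‖∇V‖²_F` (`‖∇V‖²_F = ∑ᵢ ‖∇Vᵢ‖²`,
  `frobeniusNormSq_fderiv_eq_sum_norm_gradient_sq`).

## References

* L. C. Evans, *Partial Differential Equations*, 2nd ed., AMS 2010, §8.1.4.b (null
  Lagrangians; determinants). [Evans2010]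
* A. J. Majda, A. L. Bertozzi, *Vorticity and Incompressible Flow*, CUP 2002, §1.2 (vector
  identities). [MajdaBertozziCUP2002]
-/

noncomputable section

open MeasureTheory Set Function Filter InnerProductSpace Matrix
open _root_.Topology
open scoped RealInnerProductSpace ContDiff BigOperators

namespace Literature.Analysis.FluidPDE

/-- The gradient of the coordinate function `z ↦ V z i` pairs with `h` to the `i`-th coordinate of
`∇V(y) h`. [folklore] -/
theorem inner_gradient_coord_eq {V : (EuclideanSpace ℝ (Fin 3)) → (EuclideanSpace ℝ (Fin 3))} {y : (EuclideanSpace ℝ (Fin 3))} (hV : DifferentiableAt ℝ V y) (i : Fin 3)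
    (h : (EuclideanSpace ℝ (Fin 3))) : ⟪gradient (fun z => V z i) y, h⟫ = fderiv ℝ V y h i := by
  rw [gradient, InnerProductSpace.toDual_symm_apply]
  have : (fun z => V z i) = (EuclideanSpace.proj i : (EuclideanSpace ℝ (Fin 3)) →L[ℝ] ℝ) ∘ V := by funext z; rfl
  rw [this, fderiv_comp y (EuclideanSpace.proj i : (EuclideanSpace ℝ (Fin 3)) →L[ℝ] ℝ).differentiableAt hV,
    ContinuousLinearMap.fderiv]
  rfl

/-- Coordinates of the coordinate gradients are the entries of the Jacobian matrix:
`(∇Vᵢ)ⱼ = (stdMatrix ∇V) i j`. [folklore] -/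
theorem gradient_coord_apply_eq_stdMatrix {V : (EuclideanSpace ℝ (Fin 3)) → (EuclideanSpace ℝ (Fin 3))} {y : (EuclideanSpace ℝ (Fin 3))} (hV : DifferentiableAt ℝ V y)
    (i j : Fin 3) :
    gradient (fun z => V z i) y j = stdMatrix (fderiv ℝ V y : (EuclideanSpace ℝ (Fin 3)) →ₗ[ℝ] (EuclideanSpace ℝ (Fin 3))) i j := by
  rw [stdMatrix_apply, ContinuousLinearMap.coe_coe, ← inner_gradient_coord_eq hV,
    EuclideanSpace.inner_single_right]
  simp

/-- **`det ∇V = ⟪∇V₀, ∇V₁ × ∇V₂⟫`**: the Jacobian determinant is the triple product of the rows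
of the Jacobian matrix. [folklore] -/
theorem det_fderiv_eq_inner_gradient_cross {V : (EuclideanSpace ℝ (Fin 3)) → (EuclideanSpace ℝ (Fin 3))} {y : (EuclideanSpace ℝ (Fin 3))} (hV : DifferentiableAt ℝ V y) :
    LinearMap.det (fderiv ℝ V y : (EuclideanSpace ℝ (Fin 3)) →ₗ[ℝ] (EuclideanSpace ℝ (Fin 3))) =
      ⟪gradient (fun z => V z 0) y,
        cross (gradient (fun z => V z 1) y) (gradient (fun z => V z 2) y)⟫ := by
  set M := stdMatrix (fderiv ℝ V y : (EuclideanSpace ℝ (Fin 3)) →ₗ[ℝ] (EuclideanSpace ℝ (Fin 3))) with hM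
  have hdet : LinearMap.det (fderiv ℝ V y : (EuclideanSpace ℝ (Fin 3)) →ₗ[ℝ] (EuclideanSpace ℝ (Fin 3))) = M.det :=
    (LinearMap.det_toMatrix (EuclideanSpace.basisFun (Fin 3) ℝ).toBasis
      (fderiv ℝ V y : (EuclideanSpace ℝ (Fin 3)) →ₗ[ℝ] (EuclideanSpace ℝ (Fin 3)))).symm
  have hrow : ∀ i, WithLp.ofLp (gradient (fun z => V z i) y) = M i := by
    intro i; funext j; exact gradient_coord_apply_eq_stdMatrix hV i j
  rw [hdet, cross, EuclideanSpace.inner_eq_star_dotProduct, WithLp.ofLp_toLp, star_trivial,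
    dotProduct_comm, hrow 0, hrow 1, hrow 2, triple_product_eq_det]
  congr 1
  ext i j
  fin_cases i <;> rfl

/-- The gradient of a `C^{n+1}` function is `C^n`. [folklore] -/
theorem contDiff_gradient_of_contDiff_succ {f : (EuclideanSpace ℝ (Fin 3)) → ℝ} {n : ℕ∞} (hf : ContDiff ℝ (n + 1) f) :
    ContDiff ℝ n (gradient f) := by
  have : gradient f = (InnerProductSpace.toDual ℝ (EuclideanSpace ℝ (Fin 3))).symm ∘ fderiv ℝ f := by funext y; rfl
  rw [this]
  exact (InnerProductSpace.toDual ℝ (EuclideanSpace ℝ (Fin 3))).symm.toContinuousLinearEquiv.contDiff.comp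
    (hf.fderiv_right le_rfl)

/-- **`div (∇f × ∇g) = 0`** for `C²` functions (`div (a × b) = b·curl a − a·curl b` and
`curl ∇ = 0`). [cite: MajdaBertozziCUP2002, §1.2 (vector identities)] -/
theorem divergence_cross_gradient_gradient {f g : (EuclideanSpace ℝ (Fin 3)) → ℝ} (hf : ContDiff ℝ 2 f) (hg : ContDiff ℝ 2 g)
    (y : (EuclideanSpace ℝ (Fin 3))) :
    VectorCalculus.divergence (fun z => cross (gradient f z) (gradient g z)) y = 0 := by
  have hf1 : ContDiff ℝ 1 (gradient f) := contDiff_gradient_of_contDiff_succ (n := 1) hf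
  have hg1 : ContDiff ℝ 1 (gradient g) := contDiff_gradient_of_contDiff_succ (n := 1) hg
  rw [divergence_cross_holds _ _ y (hf1.differentiable one_ne_zero y) (hg1.differentiable one_ne_zero y),
    curl_gradient_eq_zero_holds f hf y, curl_gradient_eq_zero_holds g hg y, inner_zero_right,
    inner_zero_right, sub_zero]

/-- **The null-Lagrangian flux identity** `∫ φ det ∇V = −∫ V₀ ⟪∇V₁ × ∇V₂, ∇φ⟫` for `V ∈ C^∞`
and a compactly supported `φ ∈ C^∞` (`det ∇V = div(V₀ ∇V₁ × ∇V₂)`; Evans, §8.1.4.b). [cite: Evans2010, §8.1.4.b (determinants are null Lagrangians)] -/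
theorem integral_mul_det_fderiv_eq {V : (EuclideanSpace ℝ (Fin 3)) → (EuclideanSpace ℝ (Fin 3))} (hV : ContDiff ℝ ∞ V) {φ : (EuclideanSpace ℝ (Fin 3)) → ℝ}
    (hφ : ContDiff ℝ ∞ φ) (hφc : HasCompactSupport φ) :
    ∫ y, φ y * LinearMap.det (fderiv ℝ V y : (EuclideanSpace ℝ (Fin 3)) →ₗ[ℝ] (EuclideanSpace ℝ (Fin 3))) =
      -∫ y, V y 0 * ⟪cross (gradient (fun z => V z 1) y) (gradient (fun z => V z 2) y),
        gradient φ y⟫ := by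
  -- the coordinate functions and their gradients
  have hVi : ∀ i : Fin 3, ContDiff ℝ ∞ fun z => V z i := fun i =>
    (EuclideanSpace.proj i : (EuclideanSpace ℝ (Fin 3)) →L[ℝ] ℝ).contDiff.comp hV
  have hVi2 : ∀ i : Fin 3, ContDiff ℝ 2 fun z => V z i := fun i => (hVi i).of_le (by norm_cast)
  have hVi1 : ∀ i : Fin 3, ContDiff ℝ 1 fun z => V z i := fun i => (hVi i).of_le (by norm_cast)
  have hgi : ∀ i : Fin 3, ContDiff ℝ 1 (gradient fun z => V z i) := fun i =>
    contDiff_gradient_of_contDiff_succ (n := 1) (hVi2 i)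
  have hdV : ∀ y, DifferentiableAt ℝ V y := fun y => (hV.differentiable (by simp)) y
  set Y : (EuclideanSpace ℝ (Fin 3)) → (EuclideanSpace ℝ (Fin 3)) := fun z => cross (gradient (fun z => V z 1) z) (gradient (fun z => V z 2) z) with hY
  have hY1 : ContDiff ℝ 1 Y := by
    have e : Y = fun z => crossCLM (gradient (fun z => V z 1) z) (gradient (fun z => V z 2) z) := by
      funext z; rw [hY]; rfl
    rw [e]
    exact crossCLM.isBoundedBilinearMap.contDiff.comp ((hgi 1).prodMk (hgi 2))
  have hφ1 : ContDiff ℝ 1 φ := hφ.of_le (by norm_cast)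
  -- `∫ V₀ div (φ Y) + ∫ ⟪φ Y, ∇V₀⟫ = 0`
  have hφY1 : ContDiff ℝ 1 fun z => φ z • Y z := hφ1.smul hY1
  have hφYc : HasCompactSupport fun z => φ z • Y z := hφc.smul_right
  have key := integral_mul_divergence_add_eq_zero_right (hVi1 0) hφY1 hφYc
  -- `div (φ Y) = ⟪Y, ∇φ⟫` since `div Y = 0`
  have hdiv : ∀ y, VectorCalculus.divergence (fun z => φ z • Y z) y = ⟪Y y, gradient φ y⟫ := by
    intro y
    rw [divergence_smul_apply (hφ1.differentiable one_ne_zero y) (hY1.differentiable one_ne_zero y)]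
    rw [show VectorCalculus.divergence Y y = 0 from
      divergence_cross_gradient_gradient (hVi2 1) (hVi2 2) y, mul_zero, zero_add]
  -- `⟪φ Y, ∇V₀⟫ = φ det ∇V`
  have hpair : ∀ y, ⟪φ y • Y y, gradient (fun z => V z 0) y⟫ =
      φ y * LinearMap.det (fderiv ℝ V y : (EuclideanSpace ℝ (Fin 3)) →ₗ[ℝ] (EuclideanSpace ℝ (Fin 3))) := by
    intro y
    rw [real_inner_smul_left, det_fderiv_eq_inner_gradient_cross (hdV y), real_inner_comm]
  have e1 : ∫ y, V y 0 * VectorCalculus.divergence (fun z => φ z • Y z) y =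
      ∫ y, V y 0 * ⟪Y y, gradient φ y⟫ :=
    integral_congr_ae (Eventually.of_forall fun y => by simp only [hdiv y])
  have e2 : ∫ y, ⟪φ y • Y y, gradient (fun z => V z 0) y⟫ =
      ∫ y, φ y * LinearMap.det (fderiv ℝ V y : (EuclideanSpace ℝ (Fin 3)) →ₗ[ℝ] (EuclideanSpace ℝ (Fin 3))) :=
    integral_congr_ae (Eventually.of_forall fun y => hpair y)
  rw [e1, e2] at key
  linarith

/-- The squared norm of a coordinate gradient is a row sum of squares of the Jacobian matrix:
`‖∇Vᵢ‖² = ∑ⱼ (stdMatrix ∇V)ᵢⱼ²`. [folklore] -/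
theorem norm_gradient_coord_sq_eq_sum {V : (EuclideanSpace ℝ (Fin 3)) → (EuclideanSpace ℝ (Fin 3))} {y : (EuclideanSpace ℝ (Fin 3))} (hV : DifferentiableAt ℝ V y)
    (i : Fin 3) :
    ‖gradient (fun z => V z i) y‖ ^ 2 = ∑ j, stdMatrix (fderiv ℝ V y : (EuclideanSpace ℝ (Fin 3)) →ₗ[ℝ] (EuclideanSpace ℝ (Fin 3))) i j ^ 2 := by
  rw [EuclideanSpace.norm_sq_eq]
  exact Finset.sum_congr rfl fun j _ => by
    rw [gradient_coord_apply_eq_stdMatrix hV i j, Real.norm_eq_abs, sq_abs]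

/-- The Frobenius norm of the Jacobian is the sum of the squared norms of the three coordinate
gradients (its rows). [folklore] -/
theorem frobeniusNormSq_fderiv_eq_sum_norm_gradient_sq {V : (EuclideanSpace ℝ (Fin 3)) → (EuclideanSpace ℝ (Fin 3))} {y : (EuclideanSpace ℝ (Fin 3))}
    (hV : DifferentiableAt ℝ V y) :
    frobeniusNormSq (fderiv ℝ V y) =
      ‖gradient (fun z => V z 0) y‖ ^ 2 + ‖gradient (fun z => V z 1) y‖ ^ 2 +
        ‖gradient (fun z => V z 2) y‖ ^ 2 := by
  rw [frobeniusNormSq_eq_sum_sq_stdMatrix, Fin.sum_univ_three, norm_gradient_coord_sq_eq_sum hV,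
    norm_gradient_coord_sq_eq_sum hV, norm_gradient_coord_sq_eq_sum hV]

/-- **Pointwise bound of the cubic flux**: `|V₀ ⟪∇V₁ × ∇V₂, ∇φ⟫| ≤ ½ ‖V‖ ‖∇φ‖ ‖∇V‖²_F`
(`‖a × b‖ ≤ ‖a‖ ‖b‖ ≤ ½(‖a‖² + ‖b‖²)`, coordinates bounded by the norm). [folklore] -/
theorem abs_mul_inner_cross_gradient_le {V : (EuclideanSpace ℝ (Fin 3)) → (EuclideanSpace ℝ (Fin 3))} {y : (EuclideanSpace ℝ (Fin 3))} (hV : DifferentiableAt ℝ V y)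
    (φ : (EuclideanSpace ℝ (Fin 3)) → ℝ) :
    |V y 0 * ⟪cross (gradient (fun z => V z 1) y) (gradient (fun z => V z 2) y), gradient φ y⟫| ≤
      (1 / 2) * ‖V y‖ * ‖gradient φ y‖ * frobeniusNormSq (fderiv ℝ V y) := by
  set g1 := gradient (fun z => V z 1) y
  set g2 := gradient (fun z => V z 2) y
  have h0 : |V y 0| ≤ ‖V y‖ := by
    simpa [Real.norm_eq_abs] using PiLp.norm_apply_le (V y) 0
  have hcross : ‖cross g1 g2‖ ≤ ‖g1‖ * ‖g2‖ := by
    rw [norm_cross]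
    exact mul_le_of_le_one_right (by positivity) (Real.sin_le_one _)
  have hin : |⟪cross g1 g2, gradient φ y⟫| ≤ ‖g1‖ * ‖g2‖ * ‖gradient φ y‖ :=
    (abs_real_inner_le_norm _ _).trans (mul_le_mul_of_nonneg_right hcross (norm_nonneg _))
  have hF := frobeniusNormSq_fderiv_eq_sum_norm_gradient_sq hV
  have hgg : ‖g1‖ * ‖g2‖ ≤ (1 / 2) * frobeniusNormSq (fderiv ℝ V y) := by
    rw [hF]
    nlinarith [sq_nonneg (‖g1‖ - ‖g2‖), sq_nonneg ‖gradient (fun z => V z 0) y‖]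
  rw [abs_mul]
  calc |V y 0| * |⟪cross g1 g2, gradient φ y⟫|
      ≤ ‖V y‖ * (‖g1‖ * ‖g2‖ * ‖gradient φ y‖) :=
        mul_le_mul h0 hin (abs_nonneg _) (norm_nonneg _)
    _ ≤ ‖V y‖ * ((1 / 2) * frobeniusNormSq (fderiv ℝ V y) * ‖gradient φ y‖) := by
        gcongr
    _ = (1 / 2) * ‖V y‖ * ‖gradient φ y‖ * frobeniusNormSq (fderiv ℝ V y) := by ring

end Literature.Analysis.FluidPDE

end
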